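/-
COR-CM (cell pub-hodgecm2, stage 2 of the Hodge ladder) — Δ2 BRIDGE, ORIENTATION AUDIT, T2 × T5 — THE CITATIONS AGAINST THE LITERAL SUPPLY TOKEN
(wb-8 for the T2 pair, on wb-9's word «→ wb-8: TAKE supply-corollary» (cm2 INBOX l.13542); sequel to ✔ `OrientationT2CitesVsThetaSupply` (wb-9, p374295)
and ✔ `OrientationT5ThetaTowerLevel` (wb-8, p373418)).  THEOREMS ONLY (kernel lane): no definition, no notation, no instance, no section `variable`,
no named fact, no `sorry`; nothing landed is edited or restated.  FRAMING: HC_CM is NOT proved; «Δ2 BRIDGE CLOSED» is NOT claimed; `hLiu` = READING r8;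
AUDIT module (evidence either way).
-/
import Summits.HodgeConjecture.CorCM.D2Bridge.OrientationT2CitesVsThetaSupply
import Summits.HodgeConjecture.CorCM.D2Bridge.OrientationT5ThetaTowerLevel
import HarnessLib

/-!
# Δ2 bridge, orientation audit T2 × T5 — the displayed citations against the LITERAL single-level supply token

✔ `false_of_cites_of_thetaOf_ne_zero` (wb-9) consumes ONE non-zero theta class at a level `Γ` BELOW CONJ-THREE (`Γ.BelowConjThree`).  The
tree's supply statements are keyed at ANY level — `∃ Γ, ∃ ω ∈ Θ_k(Γ), ω ≠ 0` (`WeilPairData.supply` ∕ `WeilLineData.supply`,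
`HodgeCM/Model/SupplyResidual.lean` :260, `SupplyInstance_2.lean` :70; each conjunct of `ThetaModel.Open_supply`, `Automorphic/ThetaWedgeSplit.lean` :110,
at a theta model whose `Theta` is `thetaOf _ (thetaClassInputOf _ X)`).  ✔ `exists_belowConjThree_mem_thetaOf_ne_zero` (wb-8) lowers any such class
to a tower level, so the literal token suffices:

* **`false_of_cites_of_thetaSupply`** — the binders of `false_of_cites_of_thetaOf_ne_zero` through `hμsep` VERBATIM (theta rows `hGR×5, μ, hΔ×3`,
  `F` Galois CM with `6 ≤ [F:ℚ]`, `V`, `c`, `GOG V c`, `V.Hm` anisotropic, `k`, `h`, `Φ`, `h21`, the five displayed cites of ✔ `Thm418CAtPin.thm418C_atPin`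
  at `a₀ := a_k`), then ONE token `hΘ : ∃ Γ, ∃ ω ∈ Θ_k(Γ), ω ≠ 0` (ANY level) ⟹ `False`.

The companion file `OrientationT2CitesVacuityAtGoodCtx` (wb-8, p374739) discharges even `hΘ` at the rows of record from the tree's own supply chain;
this file is the generic-rows form every other instance (other splitting rows `hGR…`, other weight tables `μ`) consumes.  Which displayed row carries
the clash is NOT decided here; nothing is asserted inhabited; HC_CM is NOT proved; «Δ2 BRIDGE CLOSED» is NOT claimed.

## References
* [Liu2021] Y. Liu, *Fourier–Jacobi cycles and arithmetic relative trace formula*, Camb. J. Math. 9 (2021) = arXiv:2102.11518: Thm. 4.18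
  (FJcycle.tex l. 2232–2245), Prop. 4.13 (l. 2113–2119), Def. 4.11, App. D Lem. D.1 (1),(3).
* [Shimura1998] G. Shimura, *Abelian Varieties with Complex Multiplication and Modular Functions*, §21.4 Thm. 21.4.
-/

set_option autoImplicit false

noncomputable section

open scoped TensorProduct Matrix

namespace Summit.HodgeConjecture.CorCM.D2Bridge

open NumberField NumberField.InfinitePlace IsDedekindDomain
open HodgeCM HodgeCM.Model HodgeCM.Model.LiuIndex HodgeCM.Model.TowerCarrier HodgeCM.Model.TowerLevel
open HodgeCM.Literature.Theta HodgeCM.Literature.Theta.LiuAlbaneseModuleDatum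
open HodgeCM.Literature.Theta.LiuAlbaneseModuleDatum.D2Bridge (HcmPieces)
open Summit.HodgeConjecture.CorCM.Model Summit.HodgeConjecture.CorCM.Transposition
open Literature.AlgebraicGeometry.Motives (CMType)
open Literature.AlgebraicGeometry.HodgeTheory Literature.NumberTheory.Automorphic.PicardCM
open Literature.AlgebraicGeometry.ShimuraVarieties.UnitaryCanonicalModel
open Literature.NumberTheory.ComplexMultiplication
open Literature.NumberTheory.Automorphic
open Literature.NumberTheory.Automorphic.IdeleClassGroup (toHeckeCharacter isUnitary_toHeckeCharacter)
open Literature.NumberTheory.Automorphic.Liu2021 Literature.NumberTheory.Automorphic.Liu2021.AppendixC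
open Literature.NumberTheory.Automorphic.Liu2021.AppendixC.RestOne
open Literature.NumberTheory.Automorphic.Liu2021.Def411WeilCarriers (locF Rep)
open Literature.NumberTheory.GelbartRogawski1991 Literature.NumberTheory.GelbartRogawski1991.UnitaryDualPair
open Literature.NumberTheory.GelbartRogawski1991.UnitaryDualPair.LocalSplitting (localMu norm_localMu continuous_localMu
  localMu_toLocalRing_eq_one_iff)
open Literature.NumberTheory.Transcendental (Arapura2012_Cor_15_4_6)
open Literature.RepresentationTheory Literature.RepresentationTheory.Liu2021
open Summit.HodgeConjecture.CorCM.Transposition.OmegaTransport (realUnit)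
open HodgeCM.Model.ArchSideTerm (e₁)
open HodgeCM.Model.SInstance HodgeCM.Model.ThetaAdelicSide HodgeCM.Model.ThetaSpace
open HodgeCM.Model.HypCensus HodgeCM.Model.SupplyInstance
open Literature.AlgebraicGeometry.ShimuraVarieties Literature.NumberTheory.Automorphic.UnitaryGroup
open Literature.Geometry.ComplexHyperbolic.BallModel (U21 x₀)
open MulAction WeightForms

/-! ## The displayed citations (with `h21`, `h`) against the literal supply token `∃ Γ, ∃ ω ∈ Θ_k(Γ), ω ≠ 0` -/

set_option synthInstance.maxHeartbeats 400000 in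
set_option maxHeartbeats 3200000 in
/-- **cites ∧ `h21` ∧ `h` ∧ (pin theta model rows) ∧ good anisotropic context ∧ the LITERAL supply token of slot `k` ⟹ `False`**, `F/ℚ` Galois.
Binders through `hμsep` are VERBATIM those of ✔ `false_of_cites_of_thetaOf_ne_zero`; its last five binders `{Γ} hΓ {ω} hω hne` (a non-zero class at a
level below conj-three) are replaced by the ANY-level token `hΘ` — the shape of `WeilPairData.supply` (`SupplyResidual.lean` :260) and of each conjunct
of `ThetaModel.Open_supply` (`ThetaWedgeSplit.lean` :110) — lowered to a tower level by ✔ `exists_belowConjThree_mem_thetaOf_ne_zero` (level pull-back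
along `coverOf`, injective by the transfer).  No `h418`, no (c)∕(d), no `Prop413`, no `hΘ′`; HC_CM is NOT proved.
[cite: Liu2021, Thm. 4.18 (FJcycle.tex l. 2232–2245); Prop. 4.13 (l. 2113–2119); App. D Lem. D.1 (1),(3)] [cite: Shimura1998, §21.4 Thm. 21.4] -/
theorem false_of_cites_of_thetaSupply
    (hGR : ∀ {L : HodgeCM.CMField} {ι₁ : L →+* ℂ} (V : HodgeCM.HermSpace3 L ι₁) (c : SeesawCtx L),
      (cmSplittingDatum (L : Type) finProdFinEquiv (frameD V) (frameD_real V) (frameD_ne V) (dW c.D) (dW_real c.D)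
        (dW_ne c.D)).CompatibleSplitting)
    (hGR₀ : ∀ {L : HodgeCM.CMField} {ι₁ : L →+* ℂ} (V : HodgeCM.HermSpace3 L ι₁) (c : SeesawCtx L),
      (cmSplittingDatum (L : Type) (e₁) (frameD V) (frameD_real V) (frameD_ne V) (lineVec (L : Type) (dW c.D 0))
        (fun _ => dW_real c.D 0) (fun _ => dW_ne c.D 0)).CompatibleSplitting)
    (hGR₁ : ∀ {L : HodgeCM.CMField} {ι₁ : L →+* ℂ} (V : HodgeCM.HermSpace3 L ι₁) (c : SeesawCtx L),
      (cmSplittingDatum (L : Type) (e₁) (frameD V) (frameD_real V) (frameD_ne V) (lineVec (L : Type) (dW c.D 1))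
        (fun _ => dW_real c.D 1) (fun _ => dW_ne c.D 1)).CompatibleSplitting)
    (hGR₂ : ∀ {L : HodgeCM.CMField} {ι₁ : L →+* ℂ} (V : HodgeCM.HermSpace3 L ι₁) (c : SeesawCtx L),
      (cmSplittingDatum (L : Type) (e₁) (frameD V) (frameD_real V) (frameD_ne V) (lineVec (L : Type) (ArchSideTerm.dW' c.D 0))
        (fun _ => ArchSideTerm.dW'_real c.D 0) (fun _ => ArchSideTerm.dW'_ne c.D 0)).CompatibleSplitting)
    (hGR₃ : ∀ {L : HodgeCM.CMField} {ι₁ : L →+* ℂ} (V : HodgeCM.HermSpace3 L ι₁) (c : SeesawCtx L),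
      (cmSplittingDatum (L : Type) (e₁) (frameD V) (frameD_real V) (frameD_ne V) (lineVec (L : Type) (ArchSideTerm.dW' c.D 1))
        (fun _ => ArchSideTerm.dW'_real c.D 1) (fun _ => ArchSideTerm.dW'_ne c.D 1)).CompatibleSplitting)
    (μ : ∀ {L : HodgeCM.CMField}, SeesawCtx L → Fin 4 → NumberField.InfinitePlace (L : Type) → ℤ)
    (hΔ₁ : ∀ {L : HodgeCM.CMField} {ι₁ : L →+* ℂ} (V : HodgeCM.HermSpace3 L ι₁) (c : SeesawCtx L), ∀ hc : GOG V c,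
      ArchSideTerm.slotTypeVec V c (hGR V c) (hGR₀ V c) (hGR₁ V c) (hGR₂ V c) (hGR₃ V c) (hG_GOG V c hc) 1 -
        ArchSideTerm.slotTypeVec V c (hGR V c) (hGR₀ V c) (hGR₁ V c) (hGR₂ V c) (hGR₃ V c) (hG_GOG V c hc) 0 = μ c 1 - μ c 0)
    (hΔ₂ : ∀ {L : HodgeCM.CMField} {ι₁ : L →+* ℂ} (V : HodgeCM.HermSpace3 L ι₁) (c : SeesawCtx L), ∀ hc : GOG V c,
      ArchSideTerm.slotTypeVec V c (hGR V c) (hGR₀ V c) (hGR₁ V c) (hGR₂ V c) (hGR₃ V c) (hG_GOG V c hc) 2 -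
        ArchSideTerm.slotTypeVec V c (hGR V c) (hGR₀ V c) (hGR₁ V c) (hGR₂ V c) (hGR₃ V c) (hG_GOG V c hc) 0 = μ c 2 - μ c 0)
    (hΔ₃ : ∀ {L : HodgeCM.CMField} {ι₁ : L →+* ℂ} (V : HodgeCM.HermSpace3 L ι₁) (c : SeesawCtx L), ∀ hc : GOG V c,
      ArchSideTerm.slotTypeVec V c (hGR V c) (hGR₀ V c) (hGR₁ V c) (hGR₂ V c) (hGR₃ V c) (hG_GOG V c hc) 3 -
        ArchSideTerm.slotTypeVec V c (hGR V c) (hGR₀ V c) (hGR₁ V c) (hGR₂ V c) (hGR₃ V c) (hG_GOG V c hc) 0 = μ c 3 - μ c 0)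
    (F : HodgeCM.CMField) [IsGalois ℚ (F : Type)] (h6 : 6 ≤ Module.finrank ℚ (F : Type))
    {ι₁ : (F : Type) →+* ℂ} (V : HodgeCM.HermSpace3 F ι₁) (c : SeesawCtx F) (hc : GOG V c) (hVan : IsAnisotropic F V.Hm) (k : Fin 4)
    (h : exists_recordSystem) (Φ : CMType (F : Type)) (h21 : shimura1998_thm21_4_casselman)
    -- the displayed citation binders of `Thm418CAtPin.thm418C_atPin` at `a₀ := a_k`, VERBATIM
    (hLiu : ∀ (i : (I V (repAt (⟨c.D.a k, c.D.a_real k, c.D.a_ne k⟩ : RealScalar F)) (muLiu ι₁ GramClass.rep))) (μ : Literature.NumberTheory.Automorphic.IdeleClassGroup (F : Type) →ₜ* Circle)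
      (hμ : IdeleClassGroup.IsConjugateSymplectic (F : Type) μ) (hw : IdeleClassGroup.HasWeight (F : Type) μ 1),
      Thm418AsPrinted (toThm418Data _ (restOfCharDeltaPrimeLine h ⟨F.K⟩ h6 ι₁ (⟨V.Hm, V.isHermitian, V.signature_ι₁, V.posDef_of_ne⟩) Φ e₁ (frameD V) (frameD_real V) (frameD_ne V) (ιVE
            V) (repAt (⟨c.D.a k, c.D.a_real k, c.D.a_ne k⟩ : RealScalar F) (Sigma.fst i)).1 (repAt (⟨c.D.a k, c.D.a_real k, c.D.a_ne k⟩ : RealScalar F) (Sigma.fst i)).2.1 (repAt (⟨c.D.a k, c.D.a_real k, c.D.a_ne k⟩ : RealScalar F) (Sigma.fst i)).2.2 μ hμ hw)))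
    -- [Liu2021, Def. 4.11] AS PRINTED at those rests
    (h411R : ∀ (i : (I V (repAt (⟨c.D.a k, c.D.a_real k, c.D.a_ne k⟩ : RealScalar F)) (muLiu ι₁ GramClass.rep))) (μ : Literature.NumberTheory.Automorphic.IdeleClassGroup (F : Type) →ₜ* Circle)
      (hμ : IdeleClassGroup.IsConjugateSymplectic (F : Type) μ) (hw : IdeleClassGroup.HasWeight (F : Type) μ 1),
      Def411AsPrinted (toThm418Data _ (restOfCharDeltaPrimeLine h ⟨F.K⟩ h6 ι₁ (⟨V.Hm, V.isHermitian, V.signature_ι₁, V.posDef_of_ne⟩) Φ e₁ (frameD V) (frameD_real V) (frameD_ne V) (ιVE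
            V) (repAt (⟨c.D.a k, c.D.a_real k, c.D.a_ne k⟩ : RealScalar F) (Sigma.fst i)).1 (repAt (⟨c.D.a k, c.D.a_real k, c.D.a_ne k⟩ : RealScalar F) (Sigma.fst i)).2.1 (repAt (⟨c.D.a k, c.D.a_real k, c.D.a_ne k⟩ : RealScalar F) (Sigma.fst i)).2.2 μ hμ hw)))
    -- [Liu2021, App. D Lem. D.1 (1)] AS PRINTED at every finite place of the local data of those rests
    (hD1 : ∀ (i : (I V (repAt (⟨c.D.a k, c.D.a_real k, c.D.a_ne k⟩ : RealScalar F)) (muLiu ι₁ GramClass.rep))) (μ : Literature.NumberTheory.Automorphic.IdeleClassGroup (F : Type) →ₜ* Circle)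
      (hμ : IdeleClassGroup.IsConjugateSymplectic (F : Type) μ) (hw : IdeleClassGroup.HasWeight (F : Type) μ 1)
      (j : (toThm418Data _ (restOfCharDeltaPrimeLine h ⟨F.K⟩ h6 ι₁ (⟨V.Hm, V.isHermitian, V.signature_ι₁, V.posDef_of_ne⟩) Φ e₁ (frameD V) (frameD_real V) (frameD_ne V) (ιVE V) (repAt
            (⟨c.D.a k, c.D.a_real k, c.D.a_ne k⟩ : RealScalar F) (Sigma.fst i)).1 (repAt (⟨c.D.a k, c.D.a_real k, c.D.a_ne k⟩ : RealScalar F) (Sigma.fst i)).2.1 (repAt (⟨c.D.a k, c.D.a_real k, c.D.a_ne k⟩ : RealScalar F) (Sigma.fst i)).2.2 μ hμ hw)).AdmIndex) (v : HeightOneSpectrum (𝓞 ↥(maximalRealSubfield (F : Type)))),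
      LemD1_1AsPrinted
      (Def411WeilCarriers.localLemD1Data ↥(maximalRealSubfield (F : Type)) (F : Type) (IsCMField.complexConj (F : Type)) 3 e₁
        (Matrix.diagonal (frameD V)) (complexConj_imagUnit (F : Type)) (imagUnit_ne_zero (F : Type)) (imagUnit_mul_self (F : Type))
        (realDiagonal_isSymm (F : Type) (frameD V) (frameD_real V)) (isUnit_det_realDiagonal (F : Type) (frameD V) (frameD_real V) (frameD_ne V))
        (realDiagonal_map (F : Type) (frameD V) (frameD_real V)).symm (((repOfLine ⟨F.K⟩ (repAt (⟨c.D.a k, c.D.a_real k, c.D.a_ne k⟩ : RealScalar F) (Sigma.fst i)).1 (repAt (⟨c.D.a k, c.D.a_real k, c.D.a_ne k⟩ : RealScalar F) (Sigma.fst i)).2.1 (repAt (⟨c.D.a k, c.D.a_real k, c.D.a_ne k⟩ : RealScalar F) (Sigma.fst i)).2.2)).toFun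
              j.1.1)
        (OmegaChiSplitting.chiLocalSplittingsD ⟨F.K⟩ e₁ (frameD V) (frameD_real V) (frameD_ne V) (toHeckeCharacter (F : Type) μ)
          ((isOscillatorChar_toHeckeCharacter_iff μ).mpr hμ) (((repOfLine ⟨F.K⟩ (repAt (⟨c.D.a k, c.D.a_real k, c.D.a_ne k⟩ : RealScalar F) (Sigma.fst i)).1 (repAt (⟨c.D.a k, c.D.a_real k, c.D.a_ne k⟩ : RealScalar F) (Sigma.fst i)).2.1 (repAt (⟨c.D.a k, c.D.a_real k, c.D.a_ne k⟩ : RealScalar F) (Sigma.fst i)).2.2)).toFun j.1.1))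
        (le_refl 3) (localMu (F : Type) (toHeckeCharacter (F : Type) μ))
        (fun v x => norm_localMu (F : Type) (toHeckeCharacter (F : Type) μ) v (isUnitary_toHeckeCharacter (F : Type) μ) x)
        (continuous_localMu (F : Type) (toHeckeCharacter (F : Type) μ))
        (fun v t => localMu_toLocalRing_eq_one_iff (F : Type) (toHeckeCharacter (F : Type) μ) v ((isOscillatorChar_toHeckeCharacter_iff μ).mpr hμ) t)
        j.1.2.1
        (Def411WeilCarriers.norm_chi_eq_one ↥(maximalRealSubfield (F : Type)) (F : Type) (IsCMField.complexConj (F : Type))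
          (Algebra.IsQuadraticExtension.finrank_eq_two ↥(maximalRealSubfield (F : Type)) (F : Type))
          (UnitaryGroup.algEquiv_ne_one_of_apply_eq_neg ↥(maximalRealSubfield (F : Type)) (F : Type) (IsCMField.complexConj (F : Type))
            (complexConj_imagUnit (F : Type)) (imagUnit_ne_zero (F : Type))) j.1.2)
        j.1.2.2.1 v))
    -- [Liu2021, Prop. 4.13] AS PRINTED over the uniform carriers of record, `H¹_{B,ι₁}(A_∞, ℂ)` read as the tower
    (h413 : ∀ i : (I V (repAt (⟨c.D.a k, c.D.a_real k, c.D.a_ne k⟩ : RealScalar F)) (muLiu ι₁ GramClass.rep)), Prop413AsPrinted (((uniformOmegaRep h ⟨F.K⟩ ι₁ (⟨V.Hm, V.isHermitian, V.signature_ι₁, V.posDef_of_ne⟩) Φ e₁ (frameD V)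
          (frameD_real V) (frameD_ne V) (ιVE V) (2 * imagUnit (HodgeCM.CMField.K F))⁻¹ (fun _ _ => (repOfLine ⟨F.K⟩ (repAt (⟨c.D.a k, c.D.a_real k, c.D.a_ne k⟩ : RealScalar F) (Sigma.fst i)).1 (repAt (⟨c.D.a k, c.D.a_real k, c.D.a_ne k⟩ : RealScalar F) (Sigma.fst i)).2.1 (repAt (⟨c.D.a k, c.D.a_real k, c.D.a_ne k⟩ : RealScalar F)
          (Sigma.fst i)).2.2)))).prop413Data ((liuDictionaryPin exists_isReal_hodgeModel_holds hodgePQ_independent_of_hodgeModel_holds BallQuotient.ballQuotientUniformised_holds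
          (cmAbelianVarietyRealised_of_eigenbasis exists_isReal_hodgeModel_holds hodgePQ_independent_of_hodgeModel_holds cmAbelianVarietyEigenbasisRealised_holds)
          Literature.NumberTheory.Transcendental.arapura2012_cor_15_4_6_holds V (I V (repAt (⟨c.D.a k, c.D.a_real k, c.D.a_ne k⟩ : RealScalar F)) (muLiu ι₁ GramClass.rep)) (line V (repAt (⟨c.D.a k, c.D.a_real k, c.D.a_ne k⟩ : RealScalar F)) (muLiu ι₁ GramClass.rep)))).H))
    -- the cross-`μ` separation leg ([Liu2021, App. D Lem. D.1 (3)] with «μ = ⊗_v μ_v»)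
    (hμsep : ∀ (i : (I V (repAt (⟨c.D.a k, c.D.a_real k, c.D.a_ne k⟩ : RealScalar F)) (muLiu ι₁ GramClass.rep))) (s t : (((uniformOmegaRep h ⟨F.K⟩ ι₁ (⟨V.Hm, V.isHermitian, V.signature_ι₁, V.posDef_of_ne⟩) Φ e₁ (frameD V) (frameD_real
          V) (frameD_ne V) (ιVE V) (2 * imagUnit (HodgeCM.CMField.K F))⁻¹ (fun _ _ => (repOfLine ⟨F.K⟩ (repAt (⟨c.D.a k, c.D.a_real k, c.D.a_ne k⟩ : RealScalar F) (Sigma.fst i)).1 (repAt (⟨c.D.a k, c.D.a_real k, c.D.a_ne k⟩ : RealScalar F) (Sigma.fst i)).2.1 (repAt (⟨c.D.a k, c.D.a_real k, c.D.a_ne k⟩ : RealScalar F) (Sigma.fst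
          i)).2.2)))).prop413Data ((liuDictionaryPin exists_isReal_hodgeModel_holds hodgePQ_independent_of_hodgeModel_holds BallQuotient.ballQuotientUniformised_holds
          (cmAbelianVarietyRealised_of_eigenbasis exists_isReal_hodgeModel_holds hodgePQ_independent_of_hodgeModel_holds cmAbelianVarietyEigenbasisRealised_holds)
          Literature.NumberTheory.Transcendental.arapura2012_cor_15_4_6_holds V (I V (repAt (⟨c.D.a k, c.D.a_real k, c.D.a_ne k⟩ : RealScalar F)) (muLiu ι₁ GramClass.rep)) (line V (repAt (⟨c.D.a k, c.D.a_real k, c.D.a_ne k⟩ : RealScalar F)) (muLiu ι₁ GramClass.rep)))).H).AdmTriple),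
      Nontrivial ((((uniformOmegaRep h ⟨F.K⟩ ι₁ (⟨V.Hm, V.isHermitian, V.signature_ι₁, V.posDef_of_ne⟩) Φ e₁ (frameD V) (frameD_real V) (frameD_ne V) (ιVE V) (2 * imagUnit
            (HodgeCM.CMField.K F))⁻¹ (fun _ _ => (repOfLine ⟨F.K⟩ (repAt (⟨c.D.a k, c.D.a_real k, c.D.a_ne k⟩ : RealScalar F) (Sigma.fst i)).1 (repAt (⟨c.D.a k, c.D.a_real k, c.D.a_ne k⟩ : RealScalar F) (Sigma.fst i)).2.1 (repAt (⟨c.D.a k, c.D.a_real k, c.D.a_ne k⟩ : RealScalar F) (Sigma.fst i)).2.2)))).prop413Data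
            ((liuDictionaryPin exists_isReal_hodgeModel_holds hodgePQ_independent_of_hodgeModel_holds BallQuotient.ballQuotientUniformised_holds (cmAbelianVarietyRealised_of_eigenbasis
            exists_isReal_hodgeModel_holds hodgePQ_independent_of_hodgeModel_holds cmAbelianVarietyEigenbasisRealised_holds)
            Literature.NumberTheory.Transcendental.arapura2012_cor_15_4_6_holds V (I V (repAt (⟨c.D.a k, c.D.a_real k, c.D.a_ne k⟩ : RealScalar F)) (muLiu ι₁ GramClass.rep)) (line V (repAt (⟨c.D.a k, c.D.a_real k, c.D.a_ne k⟩ : RealScalar F)) (muLiu ι₁ GramClass.rep)))).H).omegaAt s)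
            →
      (∃ f : (((uniformOmegaRep h ⟨F.K⟩ ι₁ (⟨V.Hm, V.isHermitian, V.signature_ι₁, V.posDef_of_ne⟩) Φ e₁ (frameD V) (frameD_real V) (frameD_ne V) (ιVE V) (2 * imagUnit
            (HodgeCM.CMField.K F))⁻¹ (fun _ _ => (repOfLine ⟨F.K⟩ (repAt (⟨c.D.a k, c.D.a_real k, c.D.a_ne k⟩ : RealScalar F) (Sigma.fst i)).1 (repAt (⟨c.D.a k, c.D.a_real k, c.D.a_ne k⟩ : RealScalar F) (Sigma.fst i)).2.1 (repAt (⟨c.D.a k, c.D.a_real k, c.D.a_ne k⟩ : RealScalar F) (Sigma.fst i)).2.2)))).prop413Data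
            ((liuDictionaryPin exists_isReal_hodgeModel_holds hodgePQ_independent_of_hodgeModel_holds BallQuotient.ballQuotientUniformised_holds (cmAbelianVarietyRealised_of_eigenbasis
            exists_isReal_hodgeModel_holds hodgePQ_independent_of_hodgeModel_holds cmAbelianVarietyEigenbasisRealised_holds)
            Literature.NumberTheory.Transcendental.arapura2012_cor_15_4_6_holds V (I V (repAt (⟨c.D.a k, c.D.a_real k, c.D.a_ne k⟩ : RealScalar F)) (muLiu ι₁ GramClass.rep)) (line V (repAt (⟨c.D.a k, c.D.a_real k, c.D.a_ne k⟩ : RealScalar F)) (muLiu ι₁ GramClass.rep)))).H).omegaAt s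
            ≃ₗ[ℂ]
          (((uniformOmegaRep h ⟨F.K⟩ ι₁ (⟨V.Hm, V.isHermitian, V.signature_ι₁, V.posDef_of_ne⟩) Φ e₁ (frameD V) (frameD_real V) (frameD_ne V) (ιVE V) (2 * imagUnit (HodgeCM.CMField.K
                F))⁻¹ (fun _ _ => (repOfLine ⟨F.K⟩ (repAt (⟨c.D.a k, c.D.a_real k, c.D.a_ne k⟩ : RealScalar F) (Sigma.fst i)).1 (repAt (⟨c.D.a k, c.D.a_real k, c.D.a_ne k⟩ : RealScalar F) (Sigma.fst i)).2.1 (repAt (⟨c.D.a k, c.D.a_real k, c.D.a_ne k⟩ : RealScalar F) (Sigma.fst i)).2.2)))).prop413Data ((liuDictionaryPin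
                exists_isReal_hodgeModel_holds hodgePQ_independent_of_hodgeModel_holds BallQuotient.ballQuotientUniformised_holds (cmAbelianVarietyRealised_of_eigenbasis
                exists_isReal_hodgeModel_holds hodgePQ_independent_of_hodgeModel_holds cmAbelianVarietyEigenbasisRealised_holds)
                Literature.NumberTheory.Transcendental.arapura2012_cor_15_4_6_holds V (I V (repAt (⟨c.D.a k, c.D.a_real k, c.D.a_ne k⟩ : RealScalar F)) (muLiu ι₁ GramClass.rep)) (line V (repAt (⟨c.D.a k, c.D.a_real k, c.D.a_ne k⟩ : RealScalar F)) (muLiu ι₁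
                GramClass.rep)))).H).omegaAt t,
        ∀ (g : ↥V.adelicFin) (v : (((uniformOmegaRep h ⟨F.K⟩ ι₁ (⟨V.Hm, V.isHermitian, V.signature_ι₁, V.posDef_of_ne⟩) Φ e₁ (frameD V) (frameD_real V) (frameD_ne V) (ιVE V) (2 *
              imagUnit (HodgeCM.CMField.K F))⁻¹ (fun _ _ => (repOfLine ⟨F.K⟩ (repAt (⟨c.D.a k, c.D.a_real k, c.D.a_ne k⟩ : RealScalar F) (Sigma.fst i)).1 (repAt (⟨c.D.a k, c.D.a_real k, c.D.a_ne k⟩ : RealScalar F) (Sigma.fst i)).2.1 (repAt (⟨c.D.a k, c.D.a_real k, c.D.a_ne k⟩ : RealScalar F) (Sigma.fst i)).2.2)))).prop413Data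
              ((liuDictionaryPin exists_isReal_hodgeModel_holds hodgePQ_independent_of_hodgeModel_holds BallQuotient.ballQuotientUniformised_holds
              (cmAbelianVarietyRealised_of_eigenbasis exists_isReal_hodgeModel_holds hodgePQ_independent_of_hodgeModel_holds cmAbelianVarietyEigenbasisRealised_holds)
              Literature.NumberTheory.Transcendental.arapura2012_cor_15_4_6_holds V (I V (repAt (⟨c.D.a k, c.D.a_real k, c.D.a_ne k⟩ : RealScalar F)) (muLiu ι₁ GramClass.rep)) (line V (repAt (⟨c.D.a k, c.D.a_real k, c.D.a_ne k⟩ : RealScalar F)) (muLiu ι₁ GramClass.rep)))).H).omegaAt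
              s),
          f ((((uniformOmegaRep h ⟨F.K⟩ ι₁ (⟨V.Hm, V.isHermitian, V.signature_ι₁, V.posDef_of_ne⟩) Φ e₁ (frameD V) (frameD_real V) (frameD_ne V) (ιVE V) (2 * imagUnit
                (HodgeCM.CMField.K F))⁻¹ (fun _ _ => (repOfLine ⟨F.K⟩ (repAt (⟨c.D.a k, c.D.a_real k, c.D.a_ne k⟩ : RealScalar F) (Sigma.fst i)).1 (repAt (⟨c.D.a k, c.D.a_real k, c.D.a_ne k⟩ : RealScalar F) (Sigma.fst i)).2.1 (repAt (⟨c.D.a k, c.D.a_real k, c.D.a_ne k⟩ : RealScalar F) (Sigma.fst i)).2.2)))).prop413Data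
                ((liuDictionaryPin exists_isReal_hodgeModel_holds hodgePQ_independent_of_hodgeModel_holds BallQuotient.ballQuotientUniformised_holds
                (cmAbelianVarietyRealised_of_eigenbasis exists_isReal_hodgeModel_holds hodgePQ_independent_of_hodgeModel_holds cmAbelianVarietyEigenbasisRealised_holds)
                Literature.NumberTheory.Transcendental.arapura2012_cor_15_4_6_holds V (I V (repAt (⟨c.D.a k, c.D.a_real k, c.D.a_ne k⟩ : RealScalar F)) (muLiu ι₁ GramClass.rep)) (line V (repAt (⟨c.D.a k, c.D.a_real k, c.D.a_ne k⟩ : RealScalar F)) (muLiu ι₁ GramClass.rep)))).H).rhoAt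
                s g v) =
            (((uniformOmegaRep h ⟨F.K⟩ ι₁ (⟨V.Hm, V.isHermitian, V.signature_ι₁, V.posDef_of_ne⟩) Φ e₁ (frameD V) (frameD_real V) (frameD_ne V) (ιVE V) (2 * imagUnit (HodgeCM.CMField.K
                  F))⁻¹ (fun _ _ => (repOfLine ⟨F.K⟩ (repAt (⟨c.D.a k, c.D.a_real k, c.D.a_ne k⟩ : RealScalar F) (Sigma.fst i)).1 (repAt (⟨c.D.a k, c.D.a_real k, c.D.a_ne k⟩ : RealScalar F) (Sigma.fst i)).2.1 (repAt (⟨c.D.a k, c.D.a_real k, c.D.a_ne k⟩ : RealScalar F) (Sigma.fst i)).2.2)))).prop413Data ((liuDictionaryPin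
                  exists_isReal_hodgeModel_holds hodgePQ_independent_of_hodgeModel_holds BallQuotient.ballQuotientUniformised_holds (cmAbelianVarietyRealised_of_eigenbasis
                  exists_isReal_hodgeModel_holds hodgePQ_independent_of_hodgeModel_holds cmAbelianVarietyEigenbasisRealised_holds)
                  Literature.NumberTheory.Transcendental.arapura2012_cor_15_4_6_holds V (I V (repAt (⟨c.D.a k, c.D.a_real k, c.D.a_ne k⟩ : RealScalar F)) (muLiu ι₁ GramClass.rep)) (line V (repAt (⟨c.D.a k, c.D.a_real k, c.D.a_ne k⟩ : RealScalar F)) (muLiu ι₁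
                  GramClass.rep)))).H).rhoAt t g (f v)) →
      s.1.μ = t.1.μ)
    -- the LITERAL single-level supply token of slot `k` (ANY level)
    (hΘ : ∃ Γ : HodgeCM.Level V, ∃ ω ∈ thetaOf _ (thetaClassInputOf _ (fun V c => thetaSpaceInputOf exists_isReal_hodgeModel_holds hodgePQ_independent_of_hodgeModel_holds
        BallQuotient.ballQuotientUniformised_holds
        (cmAbelianVarietyRealised_of_eigenbasis exists_isReal_hodgeModel_holds hodgePQ_independent_of_hodgeModel_holds cmAbelianVarietyEigenbasisRealised_holds)
        (SROGT'C @hGR @hGR₀ @hGR₁ @hGR₂ @hGR₃ @μ hΔ₁ hΔ₂ hΔ₃) V c)) V c k Γ, ω ≠ 0) : False := by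
  obtain ⟨Γ, ω, hω, hne⟩ := hΘ
  obtain ⟨Γ', -, hΓ', ω', hω', hne'⟩ := exists_belowConjThree_mem_thetaOf_ne_zero exists_isReal_hodgeModel_holds hodgePQ_independent_of_hodgeModel_holds
    BallQuotient.ballQuotientUniformised_holds
    (cmAbelianVarietyRealised_of_eigenbasis exists_isReal_hodgeModel_holds hodgePQ_independent_of_hodgeModel_holds cmAbelianVarietyEigenbasisRealised_holds)
    Literature.NumberTheory.Transcendental.arapura2012_cor_15_4_6_holds
    _ V c k Γ hω hne
  exact false_of_cites_of_thetaOf_ne_zero @hGR @hGR₀ @hGR₁ @hGR₂ @hGR₃ @μ hΔ₁ hΔ₂ hΔ₃ F h6 V c hc hVan k h Φ h21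
    hLiu h411R hD1 h413 hμsep hΓ' hω' hne'

end Summit.HodgeConjecture.CorCM.D2Bridge

end
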